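import Mathlib.MeasureTheory.Function.Jacobian
import Mathlib.Analysis.Calculus.FDeriv.Equiv
import Mathlib.MeasureTheory.Measure.Haar.Unique
import Mathlib.Topology.Algebra.Module.FiniteDimension
import HarnessLib

/-!
# Differentiable maps between real vector spaces of the same dimension send null sets to null sets

Family-agnostic measure theory (layer `Literature/Analysis/Calculus`). Mathlib's
`MeasureTheory.addHaar_image_eq_zero_of_differentiableOn_of_addHaar_eq_zero` is stated for self-maps
`f : E → E` of one finite-dimensional real vector space and one additive Haar measure. Consumers reading
a set through a chart valued in `ℂᵐ` and a coordinate map valued in another space `ℂ^ι` of the same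
dimension (e.g. coefficient coordinates of a family of hypersurfaces) need the two-space form: for
finite-dimensional real normed spaces `E`, `F` with `finrank ℝ E = finrank ℝ F`, additive Haar measures
`μ` on `E` and `ν` on `F`, a map `f : E → F` differentiable on a `μ`-null set `s` has `ν (f '' s) = 0`.
Proof: transport through a linear isomorphism `L : F ≃L[ℝ] E` (`ContinuousLinearEquiv.ofFinrankEq`),
apply the one-space theorem to `L ∘ f`, and use that `ν.map L` is again an additive Haar measure on `E`,
hence absolutely continuous with respect to `μ` (`absolutelyContinuous_isAddHaarMeasure`).

* `addHaar_image_eq_zero_of_differentiableOn_of_finrank_eq` — the statement above;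
* `addHaar_image_eq_zero_of_differentiableOn_of_finrank_eq_iUnion` — countable-union bookkeeping form.

Everything is proved; no definitions, no named facts.

## References

* [Lee2012] J. M. Lee, Introduction to Smooth Manifolds, 2nd ed. (2012), Prop. 6.5 (a smooth map on a
  measure-zero subset of `ℝⁿ` into `ℝⁿ` has measure-zero image).
-/

noncomputable section

open MeasureTheory Module Set

namespace Literature.Analysis.Calculus

variable {E F : Type*} [NormedAddCommGroup E] [NormedSpace ℝ E] [FiniteDimensional ℝ E]
  [MeasurableSpace E] [BorelSpace E]
  [NormedAddCommGroup F] [NormedSpace ℝ F] [FiniteDimensional ℝ F] [MeasurableSpace F] [BorelSpace F]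

/-- **A differentiable map between real vector spaces of equal dimension maps null sets to null sets**
(Lee, *Introduction to Smooth Manifolds*, Prop. 6.5, for arbitrary additive Haar measures `μ` on the
source and `ν` on the target): if `finrank ℝ E = finrank ℝ F`, `f : E → F` is differentiable on `s` and
`μ s = 0`, then `ν (f '' s) = 0`. [cite: Lee2012, Prop. 6.5] -/
theorem addHaar_image_eq_zero_of_differentiableOn_of_finrank_eq
    (μ : Measure E) [μ.IsAddHaarMeasure] (ν : Measure F) [ν.IsAddHaarMeasure]
    (hEF : finrank ℝ E = finrank ℝ F) {f : E → F} {s : Set E}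
    (hf : DifferentiableOn ℝ f s) (hs : μ s = 0) : ν (f '' s) = 0 := by
  -- transport to a self-map of `E`
  let L : F ≃L[ℝ] E := ContinuousLinearEquiv.ofFinrankEq hEF.symm
  have hg : DifferentiableOn ℝ (fun x => L (f x)) s :=
    L.differentiable.comp_differentiableOn hf
  have hμ : μ ((fun x => L (f x)) '' s) = 0 :=
    addHaar_image_eq_zero_of_differentiableOn_of_addHaar_eq_zero μ hg hs
  -- `f '' s` is the preimage under `L` of the null set `(L ∘ f) '' s`
  have himage : f '' s = L ⁻¹' ((fun x => L (f x)) '' s) := by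
    ext y
    constructor
    · rintro ⟨x, hx, rfl⟩
      exact ⟨x, hx, rfl⟩
    · rintro ⟨x, hx, hxy⟩
      exact ⟨x, hx, L.injective hxy⟩
  -- `ν.map L` is an additive Haar measure on `E`, hence absolutely continuous w.r.t. `μ`
  have hmap : (ν.map L) ((fun x => L (f x)) '' s) = 0 :=
    Measure.absolutelyContinuous_isAddHaarMeasure (ν.map L) μ hμ
  have hpre : ν (L ⁻¹' ((fun x => L (f x)) '' s)) = (ν.map L) ((fun x => L (f x)) '' s) :=
    (L.toHomeomorph.toMeasurableEquiv.map_apply _).symm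
  rw [himage, hpre]
  exact hmap

/-- **Countable-union form**: if `s ⊆ ⋃ₙ sₙ` with each `sₙ` `μ`-null and `f` differentiable on each `sₙ`,
then `ν (f '' s) = 0`. [cite: Lee2012, Prop. 6.5] -/
theorem addHaar_image_eq_zero_of_differentiableOn_of_finrank_eq_iUnion
    (μ : Measure E) [μ.IsAddHaarMeasure] (ν : Measure F) [ν.IsAddHaarMeasure]
    (hEF : finrank ℝ E = finrank ℝ F) {f : E → F} {s : Set E} {ι : Type*} [Countable ι]
    (t : ι → Set E) (hst : s ⊆ ⋃ i, t i) (hf : ∀ i, DifferentiableOn ℝ f (t i))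
    (ht : ∀ i, μ (t i) = 0) : ν (f '' s) = 0 := by
  refine measure_mono_null ((image_mono hst).trans (image_iUnion (f := f) (s := t)).subset) ?_
  exact measure_iUnion_null fun i =>
    addHaar_image_eq_zero_of_differentiableOn_of_finrank_eq μ ν hEF (hf i) (ht i)

end Literature.Analysis.Calculus

end
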